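import Literature.NumberTheory.DiophantineGeometry.PastenSubexpPlaces
import Literature.Barriers.ABC.BakerMethodBoundsThreeRoutesProofs
import Literature.Barriers.ABC.BakerMethodBoundsStewartYuProofs
import HarnessLib

/-!
# Golden cusp shadow, FILE A — two GENERIC one-ratio place lemmas and the abstract endgame

Summits-side helper (theorems only; no named fact; NO `Theses` import — route-independent). FILE A of three
(`CuspFieldPencilGoldenCuspPlaces` ⟵ `CuspFieldPencilGoldenCuspData` ⟵ `CuspFieldPencilGoldenCuspShadow`) proving the
crux stmt-ABC-26026 `CuspFieldPencil.GoldenCuspShadow`.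

* `orl_arch`, `orl_padic_dvd` — ONE RATIO, every place: for clean coprime `y, z ≥ 1` with `yz > 1`, a sign `s = ±1`
  and the dirty member `m = z − s·y ≠ 0`, one call of `Pasten.approx_div` at `ξ = s·y/z` (`1 − ξ = m/z`) under the
  hypothesis `PastenApproximationBound K` gives (archimedean) `log z − log|m| < Θ₀·Y` and (`p`-adic, DIVISOR form)
  `log d ≤ Θ₀·Y·3Σ_{p∣d} p` for every `d ∣ |m|`, `Θ₀ = Θ_K(y, z; 0)`, `Y = log max(e, log y + log z)` — only the primes
  of `d` are paid for (the Stewart–Yu 1991/2001 member-restriction, [cite: EvertseGyory2015, §4.6 p. 88]); the proofs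
  follow the tree templates `Pasten.arch_bound` / `Pasten.padic_bound_a` [cite: Pasten2024, §5].
* `endgame_abstract` — pure real analysis: `y ≤ A·R^η·m·log max(e, 2y)` for every `η > 0` with `1 ≤ m ≤ R`
  ⇒ `y ≤ κ_ε·R^ε·m` (`Literature.Barriers.ABC.le_of_le_mul_log_max`, `Real.log_le_rpow_div`).

HONESTY. Baker-class bookkeeping under a hypothesis `(hP : PastenApproximationBound K)`; nothing here is abc.
References: [cite: Pasten2024, Theorem 2.1, §5]; [cite: EvertseGyory2015, Thm 4.2.1 p. 68, §4.6]; [folklore].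
-/

set_option linter.dupNamespace false

noncomputable section

open Finset Real Height
open Literature.NumberTheory.DiophantineGeometry
open Literature.NumberTheory.DiophantineGeometry.Dioph
open Literature.NumberTheory.DiophantineGeometry.Pasten
open Literature.Barriers.ABC

namespace Summit.ABC.ABC.Theorems

namespace GoldenCuspShadowBaker

/-! ## §1 The two GENERIC one-ratio place lemmas (ORL; reusable by the sibling stub and any
2-rational-cusp pencil). Data: clean coprime `y, z ∈ ℕ`, a sign `s = ±1`; the dirty member is
DETERMINED, `m = z − s·y` (`1 − s·y/z = m/z`), and is never factorised. Proof = the tree proofs of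
`Pasten.arch_bound` / `Pasten.padic_bound_a` with `a/c` replaced by `m/z` (same lines). -/

/-- **A1 · `orl_arch` [S, ≈30 ll.]** archimedean clause of `approx_div` at `ξ = s·y/z`:
`log z − log|m| < Θ₀(y,z) · log max(e, log y + log z)` (`−log|m/z| = log z − log|m|`, R2, `log_max_exp_mono`). -/
theorem orl_arch {K : ℝ} (hK : 1 ≤ K) (hP : PastenApproximationBound K) {y z : ℕ} (hy : y ≠ 0) (hz : z ≠ 0)
    (hyz : y.Coprime z) (h1 : 1 < y * z) {s : ℤ} (hs : s = 1 ∨ s = -1) (hm : (z : ℤ) - s * y ≠ 0) :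
    Real.log z - Real.log |(((z : ℤ) - s * y : ℤ) : ℝ)| <
      theta K y z 0 * Real.log (max (Real.exp 1) (Real.log y + Real.log z)) := by
  set m : ℤ := (z : ℤ) - s * y with hm_def
  have hz' : (z : ℚ) ≠ 0 := by exact_mod_cast hz
  have hzpos : (0 : ℝ) < z := by exact_mod_cast Nat.pos_of_ne_zero hz
  have hm' : (m : ℝ) ≠ 0 := by exact_mod_cast hm
  have hζ : (s : ℚ) = 1 ∨ (s : ℚ) = -1 := by
    rcases hs with hs1 | hs1 <;> simp [hs1]
  have hsub : (1 : ℚ) - (s : ℚ) * ((y : ℚ) / z) = (m : ℚ) / z := by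
    rw [eq_div_iff hz', sub_mul, one_mul, mul_assoc, div_mul_cancel₀ _ hz', hm_def]
    push_cast; ring
  have hξ1 : (s : ℚ) * ((y : ℚ) / z) ≠ 1 := by
    intro h'
    have h0 : (m : ℚ) / z = 0 := by rw [← hsub, h', sub_self]
    rcases div_eq_zero_iff.mp h0 with h'' | h''
    · exact hm (by exact_mod_cast h'')
    · exact hz' h''
  obtain ⟨hA, -⟩ := approx_div hK hP hy hz hyz h1 0 hζ hξ1
  rw [hsub] at hA
  have hcast : ((((m : ℚ) / z : ℚ)) : ℝ) = (m : ℝ) / z := by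
    rw [Rat.cast_div, Rat.cast_intCast, Rat.cast_natCast]
  rw [hcast, abs_div, abs_of_pos hzpos, Real.log_div (abs_ne_zero.mpr hm') hzpos.ne'] at hA
  have hh : logHeight₁ ((s : ℚ) * ((y : ℚ) / z)) ≤ Real.log y + Real.log z :=
    logHeight₁_sign_mul_div_le hy hz hζ
  have hΘ := theta_nonneg (zero_le_one.trans hK) y z 0
  calc Real.log z - Real.log |(m : ℝ)| = -(Real.log |(m : ℝ)| - Real.log z) := by ring
    _ < theta K y z 0 * Real.log (max (Real.exp 1) (logHeight₁ ((s : ℚ) * ((y : ℚ) / z)))) := hA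
    _ ≤ theta K y z 0 * Real.log (max (Real.exp 1) (Real.log y + Real.log z)) :=
        mul_le_mul_of_nonneg_left (log_max_exp_mono hh) hΘ

/-- **A2 · `orl_padic_dvd` [M−, ≈45 ll., the hardest helper]** `p`-adic clause in DIVISOR form: for
`d ∣ |m|`, `log d ≤ Θ₀(y,z) · log max(e, log y + log z) · 3Σ_{p∣d} p`
(per prime `p ∣ d`: `p ∤ z` since `gcd(m,z) = gcd(y,z) = 1`; `padicValRat p (m/z) = ν_p(m) ≥ ν_p(d)` by R10;
clause (ii) of R1; R6; then sum with R7 — literally the `hsum` block of `Literature.Barriers.ABC.log_lt_route_a`). -/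
theorem orl_padic_dvd {K : ℝ} (hK : 1 ≤ K) (hP : PastenApproximationBound K) {y z : ℕ} (hy : y ≠ 0) (hz : z ≠ 0)
    (hyz : y.Coprime z) (h1 : 1 < y * z) {s : ℤ} (hs : s = 1 ∨ s = -1) (hm : (z : ℤ) - s * y ≠ 0)
    {d : ℕ} (hd : d ∣ ((z : ℤ) - s * y).natAbs) :
    Real.log d ≤ theta K y z 0 * Real.log (max (Real.exp 1) (Real.log y + Real.log z)) *
      (3 * ∑ p ∈ d.primeFactors, (p : ℝ)) := by
  set m : ℤ := (z : ℤ) - s * y with hm_def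
  set Θ := theta K y z 0 with hΘ
  set Y := Real.log (max (Real.exp 1) (Real.log y + Real.log z)) with hY
  have hY1 : 1 ≤ Y := one_le_log_max_exp _
  have hΘ0 : 0 ≤ Θ := theta_nonneg (zero_le_one.trans hK) y z 0
  have hz' : (z : ℚ) ≠ 0 := by exact_mod_cast hz
  have hζ : (s : ℚ) = 1 ∨ (s : ℚ) = -1 := by
    rcases hs with hs1 | hs1 <;> simp [hs1]
  have hsub : (1 : ℚ) - (s : ℚ) * ((y : ℚ) / z) = (m : ℚ) / z := by
    rw [eq_div_iff hz', sub_mul, one_mul, mul_assoc, div_mul_cancel₀ _ hz', hm_def]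
    push_cast; ring
  have hξ1 : (s : ℚ) * ((y : ℚ) / z) ≠ 1 := by
    intro h'
    have h0 : (m : ℚ) / z = 0 := by rw [← hsub, h', sub_self]
    rcases div_eq_zero_iff.mp h0 with h'' | h''
    · exact hm (by exact_mod_cast h'')
    · exact hz' h''
  obtain ⟨-, hN⟩ := approx_div hK hP hy hz hyz h1 0 hζ hξ1
  have hh : logHeight₁ ((s : ℚ) * ((y : ℚ) / z)) ≤ Real.log y + Real.log z :=
    logHeight₁_sign_mul_div_le hy hz hζ
  have hm0 : m.natAbs ≠ 0 := Int.natAbs_ne_zero.mpr hm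
  have hd0 : d ≠ 0 := by rintro rfl; exact hm0 (Nat.eq_zero_of_zero_dvd hd)
  have hlogd : Real.log d = ∑ p ∈ d.primeFactors, (d.factorization p : ℝ) * Real.log p :=
    log_eq_sum_factorization_mul_log hd0
  have hsum : ∑ p ∈ d.primeFactors, (d.factorization p : ℝ) * Real.log p ≤
      ∑ p ∈ d.primeFactors, Θ * (3 * p * Y) := by
    refine Finset.sum_le_sum fun p hp => ?_
    have hp' := Nat.prime_of_mem_primeFactors hp
    have hpm : p ∣ m.natAbs := (Nat.dvd_of_mem_primeFactors hp).trans hd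
    -- `p ∤ z`: a common prime of `m = z - s·y` and `z` divides `s·y = ±y`, against `gcd(y,z) = 1`
    have hpz : ¬p ∣ z := by
      intro hpz
      have h₁ : (p : ℤ) ∣ m := Int.ofNat_dvd_left.mpr hpm
      have h₂ : (p : ℤ) ∣ (z : ℤ) := Int.natCast_dvd_natCast.mpr hpz
      have h₃ : (p : ℤ) ∣ s * y := by
        have := dvd_sub h₂ h₁
        rwa [hm_def, sub_sub_cancel] at this
      have h₄ : (p : ℤ) ∣ (y : ℤ) := by
        rcases hs with hs1 | hs1 <;> rw [hs1] at h₃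
        · rwa [one_mul] at h₃
        · rwa [neg_one_mul, dvd_neg] at h₃
      have hpy : p ∣ y := Int.natCast_dvd_natCast.mp h₄
      exact hp'.one_lt.ne' (Nat.dvd_one.mp (hyz.gcd_eq_one ▸ Nat.dvd_gcd hpy hpz))
    have hNp := hN p hp'
    rw [hsub] at hNp
    -- `ord_p(m/z) = ν_p(m)` since `p ∤ z`
    have hval : padicValRat p ((m : ℚ) / z) = (m.natAbs.factorization p : ℤ) := by
      haveI : Fact p.Prime := ⟨hp'⟩
      rw [padicValRat.div (by exact_mod_cast hm) hz', padicValRat.of_int, padicValRat.of_nat,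
        padicValNat.eq_zero_of_not_dvd hpz, Nat.factorization_def _ hp']
      simp [padicValInt]
    rw [hval] at hNp
    push_cast at hNp
    have h2 : (p : ℝ) / Real.log p * (Real.log p + Y) ≤ 3 * p * Y :=
      div_log_mul_add_le (by exact_mod_cast hp'.two_le) hY1
    have hfac : (d.factorization p : ℝ) ≤ m.natAbs.factorization p := by
      exact_mod_cast Finsupp.le_def.mp ((Nat.factorization_le_iff_dvd hd0 hm0).mpr hd) p
    have hp1 : (1 : ℝ) ≤ p := by exact_mod_cast hp'.one_lt.le
    have hlogp : 0 ≤ Real.log p := Real.log_nonneg hp1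
    have hpl : 0 ≤ (p : ℝ) / Real.log p := div_nonneg (by linarith) hlogp
    have h3 : (p : ℝ) / Real.log p *
          Real.log (max (Real.exp 1) (p * logHeight₁ ((s : ℚ) * ((y : ℚ) / z)))) ≤
        (p : ℝ) / Real.log p * (Real.log p + Y) :=
      mul_le_mul_of_nonneg_left ((log_max_exp_mul_le hp1).trans
        (by linarith [log_max_exp_mono (t₁ := logHeight₁ ((s : ℚ) * ((y : ℚ) / z))) hh])) hpl
    calc (d.factorization p : ℝ) * Real.log p ≤ (m.natAbs.factorization p : ℝ) * Real.log p :=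
          mul_le_mul_of_nonneg_right hfac hlogp
      _ ≤ Θ * ((p : ℝ) / Real.log p *
            Real.log (max (Real.exp 1) (p * logHeight₁ ((s : ℚ) * ((y : ℚ) / z))))) := hNp.le
      _ ≤ Θ * ((p : ℝ) / Real.log p * (Real.log p + Y)) := mul_le_mul_of_nonneg_left h3 hΘ0
      _ ≤ Θ * (3 * p * Y) := mul_le_mul_of_nonneg_left h2 hΘ0
  have hsum' : ∑ p ∈ d.primeFactors, Θ * (3 * p * Y) =
      Θ * Y * (3 * ∑ p ∈ d.primeFactors, (p : ℝ)) := by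
    rw [Finset.mul_sum, Finset.mul_sum]
    exact Finset.sum_congr rfl fun p _ => by ring
  rw [hlogd, ← hsum']; exact hsum

/-! ## §2 The abstract endgame (pure real analysis, no `u, w`) -/

/-- **E1 [S+, ≈50 ll.]** `y_i ≤ A R_i^η m_i log max(e, 2 y_i)` for every `η > 0`, with `1 ≤ m_i ≤ R_i`
⇒ `y_i ≤ κ_ε R_i^ε m_i` (`η := min ε 1 / 3`, `M := A R^η m ≥ 1`, R8: `y ≤ 2M log 4M`, `log 4M ≤ (4M)^η/η`,
`m^η ≤ R^η`, `2η + η² ≤ ε`, `Real.rpow_le_rpow_of_exponent_le` for `R ≥ 1`). Same statement as k2-g5 `endgame_abstract`. -/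
theorem endgame_abstract {ι : Type*} {y R m : ι → ℝ} (hR : ∀ i, 1 ≤ R i) (hm : ∀ i, 1 ≤ m i)
    (hmR : ∀ i, m i ≤ R i)
    (hpre : ∀ η : ℝ, 0 < η → ∃ A : ℝ, ∀ i, y i ≤ A * R i ^ η * m i * Real.log (max (Real.exp 1) (2 * y i))) :
    ∀ ε : ℝ, 0 < ε → ∃ κ : ℝ, ∀ i, y i ≤ κ * R i ^ ε * m i := by
  intro ε hε
  set η : ℝ := ε / 2 with hη
  have hη0 : 0 < η := by rw [hη]; linarith
  obtain ⟨A, hA⟩ := hpre η hη0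
  set A' : ℝ := max A 1 with hA'
  have hA'1 : 1 ≤ A' := le_max_right _ _
  have hAA' : A ≤ A' := le_max_left _ _
  refine ⟨2 * A' * (Real.log (4 * A') + (η + 1) / η), fun i => ?_⟩
  have hRi := hR i
  have hmi := hm i
  have hmRi := hmR i
  have hRpos : 0 < R i := by linarith
  have hRη1 : 1 ≤ R i ^ η := Real.one_le_rpow hRi hη0.le
  have hRη0 : 0 < R i ^ η := Real.rpow_pos_of_pos hRpos η
  have hlog1 : 1 ≤ Real.log (max (Real.exp 1) (2 * y i)) := one_le_log_max_exp _
  set M : ℝ := A' * R i ^ η * m i with hM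
  have hARη : 1 ≤ A' * R i ^ η := one_le_mul_of_one_le_of_one_le hA'1 hRη1
  have hM1 : 1 ≤ M := one_le_mul_of_one_le_of_one_le hARη hmi
  have hpre' : y i ≤ M * Real.log (max (Real.exp 1) (2 * y i)) := by
    refine (hA i).trans (mul_le_mul_of_nonneg_right ?_ (by linarith))
    exact mul_le_mul_of_nonneg_right (mul_le_mul_of_nonneg_right hAA' hRη0.le) (by linarith)
  -- self-improvement (R8)
  have hy : y i ≤ 2 * M * Real.log (4 * M) := le_of_le_mul_log_max hM1 hpre'
  -- `log (4M) ≤ log (4A') + (η + 1) log R ≤ (log (4A') + (η+1)/η) · R^η`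
  have h4M : 4 * M ≤ 4 * A' * R i ^ η * R i := by
    have : A' * R i ^ η * m i ≤ A' * R i ^ η * R i := mul_le_mul_of_nonneg_left hmRi (by linarith)
    linarith
  have h4A : (0 : ℝ) < 4 * A' := by linarith
  have hlog4M : Real.log (4 * M) ≤ Real.log (4 * A') + (η + 1) * Real.log (R i) := by
    have h1 : Real.log (4 * M) ≤ Real.log (4 * A' * R i ^ η * R i) := Real.log_le_log (by linarith) h4M
    have h2 : Real.log (4 * A' * R i ^ η * R i) = Real.log (4 * A') + (η + 1) * Real.log (R i) := by
      rw [Real.log_mul (mul_pos h4A hRη0).ne' hRpos.ne', Real.log_mul h4A.ne' hRη0.ne', Real.log_rpow hRpos]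
      ring
    linarith
  have hlogR : Real.log (R i) ≤ R i ^ η / η := Real.log_le_rpow_div hRpos.le hη0
  have hlogA : 0 ≤ Real.log (4 * A') := Real.log_nonneg (by linarith)
  have hlog4M' : Real.log (4 * M) ≤ (Real.log (4 * A') + (η + 1) / η) * R i ^ η := by
    have h1 : Real.log (4 * A') ≤ Real.log (4 * A') * R i ^ η := le_mul_of_one_le_right hlogA hRη1
    have h2 : (η + 1) * Real.log (R i) ≤ (η + 1) * (R i ^ η / η) := mul_le_mul_of_nonneg_left hlogR (by linarith)
    have h3 : (η + 1) * (R i ^ η / η) = (η + 1) / η * R i ^ η := by ring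
    rw [add_mul]; linarith
  have hM0 : 0 ≤ M := by linarith
  have hRR : R i ^ η * R i ^ η = R i ^ ε := by
    rw [← Real.rpow_add hRpos]; congr 1; rw [hη]; ring
  calc y i ≤ 2 * M * Real.log (4 * M) := hy
    _ ≤ 2 * M * ((Real.log (4 * A') + (η + 1) / η) * R i ^ η) := mul_le_mul_of_nonneg_left hlog4M' (by linarith)
    _ = 2 * A' * (Real.log (4 * A') + (η + 1) / η) * (R i ^ η * R i ^ η) * m i := by rw [hM]; ring
    _ = 2 * A' * (Real.log (4 * A') + (η + 1) / η) * R i ^ ε * m i := by rw [hRR]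

end GoldenCuspShadowBaker

end Summit.ABC.ABC.Theorems

end
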